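import Literature.Analysis.FluidPDE.CriticalRegularity
import Literature.Analysis.FluidPDE.VectorCalculus
import HarnessLib

/-!
# Barrier: an instantaneous vorticity burst of arbitrary size from smooth data small in every
# supercritical space (X. Luo 2025, Thm. 1.3) — and NOT more: sustained growth is printed as open

Barrier catalogue entry for `NavierStokesRegularity` (D-0021), the supercritical companion of
`Literature.Barriers.NavierStokesRegularity.CriticalBesovNormInflation` (Bourgain–Pavlović 2008,
norm inflation in the largest CRITICAL space) and of
`Literature.Barriers.NavierStokesRegularity.CriticalDataArbitraryNormGrowth` (Palasek 2025,
arbitrary growth from BOUNDED critical data). Vendors **Theorem 1.3** of X. Luo, *Sharp norm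
inflation for 3D Navier–Stokes equations in supercritical spaces*, arXiv:2504.08288 (2025)
[`Luo2025`] as ONE named fact `SupercriticalVorticityBurst` over the accepted whole-space
vocabulary (classical solutions `Literature.Analysis.FluidPDE.IsClassicalNSSolutionOn`, the curl
`Literature.Analysis.FluidPDE.curl`, pointwise divergence-freeness
`Literature.Analysis.FluidPDE.VectorCalculus.IsDivFree`, the tempered distribution of a field
`Literature.Analysis.FluidPDE.IsDistributionOf`, the homogeneous Littlewood–Paley Besov norms
`Literature.Analysis.FunctionSpaces.eHomBesovNorm s p q`, Mathlib's `eLpNorm · ∞`), and PROVES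
from it the no-go it carries for a priori estimates: the vorticity amplification factor of smooth
compactly supported solutions is not bounded by any function of a supercritical norm of the datum
(`SupercriticalVorticityBurst.not_amplification_le_of_supercritical_norm`).

## What is printed (arXiv:2504.08288)

* (1.1): NS on `[0,T] × ℝ³`, `∂ₜu − Δu + u·∇u + ∇p = 0`, `div u = 0` (viscosity `1`).
* **Thm. 1.1** (sharp supercritical norm inflation): for any `s ≠ 0` and `1 ≤ p, q ≤ ∞` with
  `−3 < s − 3/p < −1`, for any `ε > 0` there are `0 < t* ≤ ε` and a solution `u`, smooth on
  `[0,t*] × ℝ³`, with `u|_{t=0} = u₀ ∈ C_c^∞(ℝ³)`, `‖u₀‖_{Ḃ^s_{p,1}} ≤ ε` and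
  `‖u(t*)‖_{Ḃ^s_{p,∞}} ≥ ε⁻¹`. Rem. 1.2: the upper limit `s = −1 + 3/p` is sharp (small-data
  continuity in `Ḃ^{−1+3/p}_{p,∞}`, `p < ∞`); extends Bourgain–Pavlović to `Ḃ^{−s}_{∞,∞}`; `s > 0`:
  mixing (forward cascade), `s < 0`: un-mixing (backward cascade).
* **Thm. 1.3** (p. 3): "For any `M > 0`, there exist a time `t* > 0` and a smooth solution `u` of
  (NS) on `[0,t*]` such that its vorticity `ω = ∇ × u` satisfies `‖ω(t*)‖_{L^∞}/‖ω₀‖_{L^∞} ≥ M`. In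
  particular, the initial data `u₀ ∈ C_c^∞(ℝ³)` can be arbitrarily small in any prescribed
  supercritical (homogeneous) Sobolev/Besov space." §1.1 before it: "no rigorous lower bounds for
  [`‖ω(t)‖_∞/‖ω₀‖_∞`] have been established for solutions of the Navier–Stokes equations to date";
  after it (p. 4): "The growth in Theorem 1.3 is significant but mere for a short burst of time. To
  find potential blowup candidates, one needs to establish a feedback loop of self-sustained growth
  in (NS), which is far beyond the scope of the current paper"; §1.2 (p. 5): "our solutions exhibit
  only an instantaneous burst of growth. A central open question remains: Can solutions to (NS)
  achieve prolonged, sustained growth or even finite time blowup?"; mechanism (p. 5): NS → Euler on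
  short times in supercritical regimes; Euler → 2D Euler + transport by axisymmetric anisotropy;
  inflation from the swirl component mixed by a stationary meridional flow.
* §6.2 (proof of Thm. 1.3): "Since any supercritical Sobolev/Besov spaces embeds into `Ẇ^{2−δ,1}`
  when `δ > 0` is small enough, we apply Theorem 1.1 with `s` close to `2` and `p = 1` to obtain the
  solution with initial data that is `ε`-small in the prescribed supercritical Sobolev/Besov norm";
  `‖∇×u(t*)‖_∞ ≥ Cε^{−2}μ^{1−s}(μ²ν¹)`, `‖∇×u₀‖_∞ ≤ Cε²μ^{1−s}(μ²ν¹)`, ratio `≥ Cε^{−4} ≥ M`.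

## Rendering (WEAKER than print)

* Data: `u₀ ∈ C_c^∞(ℝ³; ℝ³)` (`ContDiff ℝ ∞`, `HasCompactSupport`), divergence free (part of
  "solution"); `0 < ‖curl u₀‖_∞ < ∞` recorded so that the printed RATIO is meaningful (in Lean:
  `M · ‖curl u₀‖_∞ ≤ ‖curl u(t*)‖_∞` in `ℝ≥0∞`, Mathlib `eLpNorm · ∞ volume`).
* Solution: `IsClassicalNSSolutionOn (Icc 0 t*) 1 0 u p` with `u 0 = u₀` (jointly smooth velocity
  and pressure on `[0,t*] × ℝ³`, pointwise equations, `ν = 1`, unforced) = the printed "smooth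
  solution of (NS) on `[0,t*]`".
* "arbitrarily small in any prescribed supercritical … Besov space": for every `(s, p, q)` in the
  printed window of Thm. 1.1, `−3 < s − 3/p < −1`, `1 ≤ p, q ≤ ∞` (for `p = ∞` Lean's
  `3 / (∞).toReal = 0` gives exactly the printed `−3 < s < −1`), and every `ε > 0`, the datum's
  tempered distribution `U₀` has `‖U₀‖_{Ḃ^s_{p,q}} ≤ ε` — by §6.2 (Thm. 1.1 at `p = 1`, `s' ∈ (0,2)`,
  `s' − 3 = s − 3/p`, and the Besov embedding `Ḃ^{s'}_{1,1} ↪ Ḃ^s_{p,q}`, constant absorbed in `ε`).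
  The restriction `s ≠ 0` of Thm. 1.1 concerns the INFLATION space and is not needed for the
  smallness; windows beyond `s − 3/p ≤ −3` are not recorded.
* Thm. 1.1 itself (inflation of `‖u(t*)‖_{Ḃ^s_{p,∞}}`) and `t* ≤ ε` are NOT recorded here (a
  separate statement; the sibling `CriticalBesovNormInflation` covers the critical endpoint).

## References

* X. Luo, *Sharp norm inflation for 3D Navier–Stokes equations in supercritical spaces*,
  arXiv:2504.08288 (2025), Thm. 1.1, Rem. 1.2, §1.1 Thm. 1.3, §1.2, §6.2. [`Luo2025`]
* J. Bourgain, N. Pavlović, J. Funct. Anal. 255 (2008), Thm. 1.1. [`BourgainPavlovic2008`]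
* J. T. Beale, T. Kato, A. Majda, Comm. Math. Phys. 94 (1984) (BKM criterion). [`BealeKatoMajda1984`]
* S. Palasek, arXiv:2509.18595 (2025), Cor. 1.5 (critical-data a priori estimates fail). [`Palasek2025`]
* H. Bahouri, J.-Y. Chemin, R. Danchin, GL 343 (2011), Def. 2.15, Prop. 2.20 (Besov embedding).
  [`BahouriCheminDanchinGL343`]
-/

noncomputable section

open MeasureTheory Set
open scoped ENNReal SchwartzMap

namespace Literature.Barriers.NavierStokesRegularity

/-- **Barrier (X. Luo 2025, Thm. 1.3): arbitrarily large INSTANTANEOUS vorticity amplification for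
smooth Navier–Stokes solutions from compactly supported data that are small in every supercritical
Besov space — rendering of the module docstring, weaker than print.** For every `M > 0`, every
exponent triple in the printed supercritical window (`−3 < s − 3/p < −1`, `1 ≤ p, q ≤ ∞`) and every
`ε > 0` there are a time `t* > 0`, a `C_c^∞` divergence-free datum `u₀ : ℝ³ → ℝ³` with
`0 < ‖curl u₀‖_∞ < ∞` whose tempered distribution has `‖·‖_{Ḃ^s_{p,q}} ≤ ε`, and a classical
solution `(u, p)` of the unforced Navier–Stokes equations (`ν = 1`) on `[0,t*] × ℝ³` with
`u(0) = u₀` and `‖curl u(t*)‖_∞ ≥ M ‖curl u₀‖_∞`. The author's own caveat: "only an instantaneous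
burst of growth … Can solutions to (NS) achieve prolonged, sustained growth or even finite time
blowup?" is the open question. [cite: Luo2025, Thm. 1.3 with §6.2 (smallness via Thm. 1.1 at p = 1 and the Besov embedding) and §1.2]

BARRIER (structured block, D-0021):
technique_class: supercritical-data-a-priori-estimate vorticity-amplification-bound small-supercritical-data-regularity persistence-of-supercritical-regularity bkm-quantity-control-from-data norm-inflation a-priori-estimate
blocks: every a priori bound of the vorticity amplification factor `sup_{t ≤ T}‖ω(t)‖_∞/‖ω₀‖_∞` (the BKM quantity's growth), or of `‖u(t)‖_{Ḃ^s_{p,∞}}` [cite: Luo2025, Thm. 1.1], for smooth compactly supported solutions in terms of a SUPERCRITICAL norm `‖u₀‖_{Ḃ^s_{p,q}}` (`s − 3/p < −1`; Sobolev `Ẇ^{s,p}` likewise) of the datum — even for arbitrarily small such norms and arbitrarily short times; in-tree: `SupercriticalVorticityBurst.not_amplification_le_of_supercritical_norm` (no non-decreasing `F` with `‖ω(t)‖_∞ ≤ F(‖u₀‖_{Ḃ^s_{p,q}})‖ω₀‖_∞`); and "persistence of regularity / stability in supercritical settings" for splitting-type (Calderón, Popov) solutions: "such solutions cannot maintain the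 initial data's regularity" [cite: Luo2025, Thm. 1.3, §1 and §1.2].
because: in supercritical regimes viscosity is dominated by the nonlinearity over the short time `t*` (NS → Euler); by axisymmetric anisotropy the dynamics reduce to a stationary meridional 2D Euler flow transporting the swirl, whose differential rotation MIXES the swirl across a thin torus (forward cascade, `s > 0`) — `‖∇×ū(t*)‖_∞ ≳ ε^{−2}μ^{1−s}(μ²ν¹)` against `‖∇×u₀‖_∞ ≲ ε²μ^{1−s}(μ²ν¹)`, ratio `≳ ε^{−4}`; smallness in any prescribed supercritical space from Thm. 1.1 at `p = 1`, `s` close to `2`, and the Besov embedding [cite: Luo2025, §1.2 (mechanism) and §6.2].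
evasions_known: (1) CRITICAL or subcritical data topologies: the solution map is continuous for small data in `Ḃ^{−1+3/p}_{p,∞}`, `p < ∞` — the line `s = −1 + 3/p` is sharp [cite: Luo2025, Rem. 1.2]; bounded CRITICAL data still allow arbitrary (but global, smooth) growth — the sibling `CriticalDataArbitraryNormGrowth` [cite: Palasek2025, Thm. 1.1]; (2) the burst is INSTANTANEOUS and one-shot: "significant but mere for a short burst of time … one needs to establish a feedback loop of self-sustained growth … far beyond the scope"; sustained growth / blow-up is the stated open question — nothing here obstructs regularity arguments that control the solution by quantities other than a supercritical norm of the datum [cite: Luo2025, §1.1 (after Thm. 1.3) and §1.2]; (3) `s = 0`, i.e. the Lebesgue spaces `L^p`, `2 < p < 3`, are NOT covered ("It remains an open question whether such norm inflation can occur in supercritical Lebesgue spaces") [cite: Luo2025, §1 after Thm. 1.1].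
scope_caveats: (a) `ℝ³`, viscosity `1`, zero force, as printed (other viscosities by the Navier–Stokes scaling, not threaded); (b) only Thm. 1.3 is recorded, with the smallness clause for the window `−3 < s − 3/p < −1` of Thm. 1.1 (the sentence "any prescribed supercritical Sobolev/Besov space" is rendered on that window; Sobolev spaces by embedding, not threaded); the inflation statement Thm. 1.1 (`‖u(t*)‖_{Ḃ^s_{p,∞}} ≥ ε⁻¹`, `t* ≤ ε`) is NOT recorded [cite: Luo2025, Thm. 1.1]; (c) `M` is reached with `t* → 0` and data of vanishing supercritical size — a regime disjoint from finite-energy `O(1)` data over `O(1)` times; the statement says nothing about blow-up or about `NavierStokesRegularity` itself, and the BKM criterion (blow-up ⟺ `∫‖ω‖_∞ = ∞`) is untouched [cite: Luo2025, §1.1]; (d) the smallness is in HOMOGENEOUS Besov norms of the tree's canonical Littlewood–Paley definition (BCD Def. 2.15), equivalent up to constants to the source's — absorbed in the arbitrary `ε` [cite: BahouriCheminDanchinGL343, Def. 2.15 and Prop. 2.20].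
status: established -/
def SupercriticalVorticityBurst : Prop :=
  ∀ M : ℝ, 0 < M →
    ∀ (s : ℝ) (p q : ℝ≥0∞) [Fact (1 ≤ p)], 1 ≤ q →
      -3 < s - 3 / p.toReal → s - 3 / p.toReal < -1 →
      ∀ ε : ℝ, 0 < ε →
        ∃ (tstar : ℝ) (u₀ : EuclideanSpace ℝ (Fin 3) → EuclideanSpace ℝ (Fin 3))
          (U₀ : 𝓢'(EuclideanSpace ℝ (Fin 3), EuclideanSpace ℂ (Fin 3)))
          (u : ℝ → EuclideanSpace ℝ (Fin 3) → EuclideanSpace ℝ (Fin 3))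
          (p' : ℝ → EuclideanSpace ℝ (Fin 3) → ℝ),
          0 < tstar ∧ ContDiff ℝ ((⊤ : ℕ∞) : WithTop ℕ∞) u₀ ∧ HasCompactSupport u₀ ∧
          Literature.Analysis.FluidPDE.VectorCalculus.IsDivFree u₀ ∧
          Literature.Analysis.FluidPDE.IsDistributionOf u₀ U₀ ∧
          Literature.Analysis.FunctionSpaces.eHomBesovNorm s p q U₀ ≤ ENNReal.ofReal ε ∧
          Literature.Analysis.FluidPDE.IsClassicalNSSolutionOn (Icc 0 tstar) 1 0 u p' ∧ u 0 = u₀ ∧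
          0 < eLpNorm (Literature.Analysis.FluidPDE.curl u₀) ∞ volume ∧
          eLpNorm (Literature.Analysis.FluidPDE.curl u₀) ∞ volume < ∞ ∧
          ENNReal.ofReal M * eLpNorm (Literature.Analysis.FluidPDE.curl u₀) ∞ volume ≤
            eLpNorm (Literature.Analysis.FluidPDE.curl (u tstar)) ∞ volume

/-- **No a priori bound of the vorticity amplification factor by a supercritical norm of the datum**
(the no-go carried by X. Luo 2025, Thm. 1.3; cf. Palasek 2025 Cor. 1.5 for the critical case),
PROVED from the fact: for every exponent triple in the window `−3 < s − 3/p < −1` and every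
non-decreasing `F : ℝ≥0∞ → ℝ`, it is NOT true that every classical solution `(u,p)` on a slab
`[0,T] × ℝ³` from a `C_c^∞` divergence-free datum `u₀` (with tempered distribution `U₀`) obeys
`‖curl u(t)‖_∞ ≤ F(‖U₀‖_{Ḃ^s_{p,q}}) · ‖curl u₀‖_∞` for all `t ∈ [0,T]`. (Take `ε = 1`,
`M > max(F(1), 0)`: the burst solution has ratio `≥ M > F(1) ≥ F(‖U₀‖)`.)
[cite: Luo2025, Thm. 1.3 and §1.1 ("no rigorous lower bounds … to date")] -/
theorem SupercriticalVorticityBurst.not_amplification_le_of_supercritical_norm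
    (h : SupercriticalVorticityBurst) (s : ℝ) (p q : ℝ≥0∞) [Fact (1 ≤ p)] (hq : 1 ≤ q)
    (hs₁ : -3 < s - 3 / p.toReal) (hs₂ : s - 3 / p.toReal < -1)
    (F : ℝ≥0∞ → ℝ) (hF : Monotone F) :
    ¬ ∀ (T : ℝ) (u₀ : EuclideanSpace ℝ (Fin 3) → EuclideanSpace ℝ (Fin 3))
        (U₀ : 𝓢'(EuclideanSpace ℝ (Fin 3), EuclideanSpace ℂ (Fin 3)))
        (u : ℝ → EuclideanSpace ℝ (Fin 3) → EuclideanSpace ℝ (Fin 3))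
        (p' : ℝ → EuclideanSpace ℝ (Fin 3) → ℝ),
        0 < T → ContDiff ℝ ((⊤ : ℕ∞) : WithTop ℕ∞) u₀ → HasCompactSupport u₀ →
        Literature.Analysis.FluidPDE.VectorCalculus.IsDivFree u₀ →
        Literature.Analysis.FluidPDE.IsDistributionOf u₀ U₀ →
        Literature.Analysis.FluidPDE.IsClassicalNSSolutionOn (Icc 0 T) 1 0 u p' → u 0 = u₀ →
        ∀ t ∈ Icc 0 T,
          eLpNorm (Literature.Analysis.FluidPDE.curl (u t)) ∞ volume ≤
            ENNReal.ofReal (F (Literature.Analysis.FunctionSpaces.eHomBesovNorm s p q U₀)) *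
              eLpNorm (Literature.Analysis.FluidPDE.curl u₀) ∞ volume := by
  intro hyp
  set M : ℝ := max (F (ENNReal.ofReal 1)) 0 + 1 with hM
  have hMpos : 0 < M := by rw [hM]; positivity
  obtain ⟨tstar, u₀, U₀, u, p', ht, hsm, hcs, hdiv, hdist, hnorm, hsol, hinit, hω₀, hω₀', hburst⟩ :=
    h M hMpos s p q hq hs₁ hs₂ 1 one_pos
  have hle := hyp tstar u₀ U₀ u p' ht hsm hcs hdiv hdist hsol hinit tstar ⟨ht.le, le_rfl⟩
  -- `M · ‖ω₀‖ ≤ ‖ω(t*)‖ ≤ F(‖U₀‖) · ‖ω₀‖`, so `M ≤ F(‖U₀‖) ≤ F(1) < M`.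
  have h1 : ENNReal.ofReal M ≤
      ENNReal.ofReal (F (Literature.Analysis.FunctionSpaces.eHomBesovNorm s p q U₀)) :=
    (ENNReal.mul_le_mul_iff_left hω₀.ne' hω₀'.ne).1 (hburst.trans hle)
  have h2 : F (Literature.Analysis.FunctionSpaces.eHomBesovNorm s p q U₀) ≤ F (ENNReal.ofReal 1) :=
    hF hnorm
  have h3 : F (ENNReal.ofReal 1) < M := by
    rw [hM]
    have := le_max_left (F (ENNReal.ofReal 1)) 0
    linarith
  have h4 : ENNReal.ofReal (F (Literature.Analysis.FunctionSpaces.eHomBesovNorm s p q U₀)) <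
      ENNReal.ofReal M :=
    (ENNReal.ofReal_le_ofReal h2).trans_lt ((ENNReal.ofReal_lt_ofReal_iff hMpos).2 h3)
  exact absurd (h1.trans_lt h4) (lt_irrefl _)

end Literature.Barriers.NavierStokesRegularity
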